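import Summits.QuantumFields.BalabanUV.T4Continuum.Spine.NE2PerturbedLayer

/-!
# T⁴ programme, spine node NE2 (U1a) — FIRST INSTANCE OF THE PERTURBED LAYER: King's `(Δ^{(k)} + B)⁻¹` structure for
# Bałaban's VECTOR propagator — a unit-scale potential `B` planted into every level; `PerturbationLaws` DISCHARGED, the
# η-rate of the unit-lattice covariance of `(Δ_a^{(k)} + t·J^{(k)}BJ^{(k)ᴴ})⁻¹` UNCONDITIONAL

Ninth generation of the NE2 prover lineage P1 of the cell `pub-balaban`, file 5.  [King1986] Lemma 4.5 p. 674 proves the η-rate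
«|C^{(k)}(x, y) − C^{(k+n)}(x, y)| ≤ CL^{−k}e^{−δ₀|x−y|}» for the scalar covariance `C^{(k)} = (Δ^{(k)} + B)⁻¹` where `B` is a FIXED
UNIT-LATTICE operator (the quadratic part of the Higgs potential) and `Δ^{(k)}` the effective Laplacian after `k` steps, by the
resolvent interpolation (4.32).  In the lineage's fine-lattice picture a unit-lattice operator `B : ℓ²(T_1; ℂ^d) → ℓ²(T_1; ℂ^d)` enters
level `k` PLANTED along King's pairings, `P_0 = B`, `P_{k+1} = J_kP_kJ_kᴴ` (`plantTow`), and this family satisfies the two typed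
inequalities of `Spine/BackgroundResolventTower.PerturbationLaws` BY CONSTRUCTION:
 * (H-cons) EXACTLY: `P_{k+1}J_k − J_kP_k = J_kP_k(J_kᴴJ_k − 1) = 0` (`plantTow_succ_mul_sub`), so `e₂ = 0`;
 * (H-bd): `‖P_k‖ ≤ ‖B‖` (`opNorm_plantTow_le`, contractions) and `‖𝒢^{(k)}‖ ≤ Cst` ((1.89), order zero) give
   `‖P_k𝒢^{(k)}‖, ‖𝒢^{(k)}P_k‖ ≤ ‖B‖·Cst` (`perturbationLaws_plantTow`).
Hence (§2) **`towerLimitRate_plantedPotential`**: for every `B` and every coupling `‖t‖·‖B‖·Cst < 1` the King-averaged unit-lattice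
covariance of `(Δ_a^{(k)} + t·P_k)⁻¹` CONVERGES as `k → ∞` with rate `L^{−k}` and constant
`Cpert(t) = CJ·(1 − ‖t‖‖B‖Cst)^{−2} + 2d·Cst·(1 − ‖t‖‖B‖Cst)^{−1}` — NO typed residual: the vector-layer transfer of King's Lemma 4.5
STRUCTURE `(Δ^{(k)} + B)⁻¹` (operator norm, finite torus), the namesake of the lineage's technique.  **`plantedPotential_lipschitz`**:
the limit moves by at most `‖t‖‖B‖Cst²(1 − ‖t‖‖B‖Cst)^{−1}` from the free limit.

HONEST FRAMING (T4-DAG p. 1).  This is NOT a background gauge field: a planted unit-scale potential is the `U = 1` vector theory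
with a King-type `B`-insertion (massive / Higgs-like quadratic term seen through the block averages); it certifies that the
resolvent route closes END TO END on a non-trivial family and fixes the constants.  The background-field instance needs (H-cons)
for DERIVATIVE-type perturbations (successor's `Support/FirstOrderBackgroundModel`).  Finite torus, linear layer, operator norm;
rates/pairing/constants OURS; NOT infinite volume / mass gap / Clay / summit progress; spine 0/9 unchanged.  HONEST DEPENDENCY:
continuum YM on T⁴ ⇐ BetaPertH ∧ nine spine estimates (0/9 proved); BetaPertH ⇐ (D1) ∧ (D4) ∧ CAP+tail; G-an2-4 gates asym, D1 and
NE2/3/4.  ABSOLUTE RULE kept; no `sorry`.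
-/

noncomputable section

open scoped BigOperators ComplexConjugate Matrix Matrix.Norms.L2Operator
open Filter Topology

namespace Summit.QuantumFields.BalabanUV.T4Continuum.PlantedPotentialRate

open Literature.MathematicalPhysics.QuantumFieldTheory.Balaban1983to89.B5Prop11Plancherel (Cst Cst_nonneg)
open Summit.QuantumFields.BalabanUV.T4Continuum
open Summit.QuantumFields.BalabanUV.T4Continuum.CovariantAveragingTower (avgTow TowerLimitRate)
open Summit.QuantumFields.BalabanUV.T4Continuum.BalabanAveragedTowerUnit (idx Qlev calGlev opNorm_Qlev_sq_le)
open Summit.QuantumFields.BalabanUV.T4Continuum.BackgroundResolventTower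
open Summit.QuantumFields.BalabanUV.T4Continuum.KingPairingPlantedLaw
open Summit.QuantumFields.BalabanUV.T4Continuum.NE2PerturbedLayer

variable {d : ℕ} (L : ℕ) [NeZero L] (M : Fin d → ℕ) [hM : ∀ μ, NeZero (M μ)]

/-! ## §1 Planting a unit-lattice operator along King's pairings -/

/-- **THE PLANTED TOWER** of a unit-lattice operator `B`: `P_0 = B`, `P_{k+1} = J_kP_kJ_kᴴ` — `B` acting on the block means of
level `k`, re-extended piecewise-constantly (King's `B` of `C^{(k)} = (Δ^{(k)} + B)⁻¹` in the fine-lattice picture).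
[cite: King1986, Lemma 4.5 p.674, p.664 (pairing)] [folklore] -/
def plantTow (B : Matrix (idx L M 0) (idx L M 0) ℂ) : (k : ℕ) → Matrix (idx L M k) (idx L M k) ℂ
  | 0 => B
  | k + 1 => JpcT L M k * plantTow B k * (JpcT L M k)ᴴ

/-- the recursion step (definitional). [folklore] -/
@[simp] theorem plantTow_succ (B : Matrix (idx L M 0) (idx L M 0) ℂ) (k : ℕ) :
    plantTow L M B (k + 1) = JpcT L M k * plantTow L M B k * (JpcT L M k)ᴴ := rfl

/-- `‖P_k‖ ≤ ‖B‖` (the pairings are contractions). [folklore] -/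
theorem opNorm_plantTow_le (B : Matrix (idx L M 0) (idx L M 0) ℂ) (k : ℕ) : ‖plantTow L M B k‖ ≤ ‖B‖ := by
  induction k with
  | zero => exact le_rfl
  | succ k ih =>
    rw [plantTow_succ]
    have hJ := opNorm_JpcT_le L M k
    have hJ' : ‖(JpcT L M k)ᴴ‖ ≤ 1 := by rw [Matrix.l2_opNorm_conjTranspose]; exact hJ
    calc ‖JpcT L M k * plantTow L M B k * (JpcT L M k)ᴴ‖ ≤ ‖JpcT L M k * plantTow L M B k‖ * ‖(JpcT L M k)ᴴ‖ :=
          Matrix.l2_opNorm_mul _ _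
      _ ≤ ‖JpcT L M k‖ * ‖plantTow L M B k‖ * ‖(JpcT L M k)ᴴ‖ :=
          mul_le_mul_of_nonneg_right (Matrix.l2_opNorm_mul _ _) (norm_nonneg _)
      _ ≤ 1 * ‖B‖ * 1 := mul_le_mul (mul_le_mul hJ ih (norm_nonneg _) zero_le_one) hJ' (norm_nonneg _) (by positivity)
      _ = ‖B‖ := by ring

/-- **(H-cons) HOLDS EXACTLY**: `P_{k+1}J_k − J_kP_k = 0` (`J_kᴴJ_k = 1`). [folklore] -/
theorem plantTow_succ_mul_sub (B : Matrix (idx L M 0) (idx L M 0) ℂ) (k : ℕ) :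
    plantTow L M B (k + 1) * JpcT L M k - JpcT L M k * plantTow L M B k = 0 := by
  rw [plantTow_succ, Matrix.mul_assoc (JpcT L M k * plantTow L M B k), JpcT_conjTranspose_mul_JpcT, Matrix.mul_one, sub_self]

variable (a : ℝ) (ha : 0 < a)

/-- **`PerturbationLaws` DISCHARGED for the planted tower**: `κ = ‖B‖·Cst`, `e₂ = 0`. [cite: Balaban1984PropagatorsI, Prop. 1.1
(1.89) p.33; King1986, Lemma 4.5 p.674] [folklore] -/
theorem perturbationLaws_plantTow (B : Matrix (idx L M 0) (idx L M 0) ℂ) :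
    PerturbationLaws (calDalev L M a ha) (plantTow L M B) (JpcT L M) (‖B‖ * Cst d a) (fun k => 0 * ((L : ℝ)⁻¹) ^ k) where
  opNorm_P_mul_inv_le := fun k =>
    (Matrix.l2_opNorm_mul _ _).trans (mul_le_mul (opNorm_plantTow_le L M B k) (opNorm_inv_calDalev_le L M a ha k)
      (norm_nonneg _) (norm_nonneg _))
  opNorm_inv_mul_P_le := fun k => by
    rw [mul_comm ‖B‖]
    exact (Matrix.l2_opNorm_mul _ _).trans (mul_le_mul (opNorm_inv_calDalev_le L M a ha k) (opNorm_plantTow_le L M B k)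
      (norm_nonneg _) (Cst_nonneg d a))
  consistent_le := fun k => by
    rw [Matrix.mul_assoc ((calDalev L M a ha (k + 1))⁻¹), plantTow_succ_mul_sub, Matrix.zero_mul, Matrix.mul_zero, norm_zero,
      zero_mul]

/-! ## §2 The η-rate of the planted-potential covariance, unconditional -/

/-- **NE2 FOR KING's `(Δ^{(k)} + B)⁻¹` STRUCTURE ON BAŁABAN's VECTOR LAYER** (`L ≥ 2`, any unit-lattice operator `B`, any coupling
`‖t‖·‖B‖·Cst < 1`): the King-averaged unit-lattice covariances `c_k(t) = (L^d)^k·Q^{(k)}(Δ_a^{(k)} + t·P_k)⁻¹Q^{(k)ᴴ}` of the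
planted tower CONVERGE, `‖c_k(t) − c_∞(t)‖ ≤ Cpert(t)·L^{−k}/(1 − L^{−1})` with
`Cpert(t) = CJ(1 − ‖t‖‖B‖Cst)^{−2} + 2d·Cst·(1 − ‖t‖‖B‖Cst)^{−1}` — NO typed residual.  Statement, pairing and constants OURS.
[cite: King1986, Lemma 4.5 (4.32)/(4.38) p.674; Balaban1984PropagatorsI, (1.69) p.29, (1.83) p.31, Prop. 1.1 (1.89) p.33] [folklore] -/
theorem towerLimitRate_plantedPotential (hL : 2 ≤ L) (B : Matrix (idx L M 0) (idx L M 0) ℂ) {t : ℂ}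
    (ht : ‖t‖ * (‖B‖ * Cst d a) < 1) :
    TowerLimitRate (Qlev L M) ((L : ℝ) ^ d) (fun k => (calDalev L M a ha k + t • plantTow L M B k)⁻¹)
      (Cpert (‖B‖ * Cst d a) (2 * d * Cst d a) (CJ d a) 0 0 t) ((L : ℝ)⁻¹) :=
  towerLimitRate_perturbed_king L M a ha hL (perturbationLaws_plantTow L M a ha B) ht

/-- the same on `pertCov`, with the Lipschitz bound of the limit against the free limit:
`‖c_∞(t) − c_∞(0)‖ ≤ ‖t‖·‖B‖Cst·Cst·(1 − ‖t‖‖B‖Cst)^{−1}`. [cite: King1986, Lemma 4.5 p.674] [folklore] -/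
theorem plantedPotential_lipschitz (hL : 2 ≤ L) (B : Matrix (idx L M 0) (idx L M 0) ℂ) {t : ℂ}
    (ht : ‖t‖ * (‖B‖ * Cst d a) < 1) :
    ∃ ct c0 : Matrix (idx L M 0) (idx L M 0) ℂ,
      Tendsto (pertCov L M a ha (plantTow L M B) t) atTop (𝓝 ct) ∧ Tendsto (pertCov L M a ha (plantTow L M B) 0) atTop (𝓝 c0) ∧
      (∀ k, ‖pertCov L M a ha (plantTow L M B) t k - ct‖
          ≤ Cpert (‖B‖ * Cst d a) (2 * d * Cst d a) (CJ d a) 0 0 t * ((L : ℝ)⁻¹) ^ k / (1 - (L : ℝ)⁻¹)) ∧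
      ‖ct - c0‖ ≤ ‖t‖ * (‖B‖ * Cst d a) * Cst d a * (1 - ‖t‖ * (‖B‖ * Cst d a))⁻¹ :=
  ne2Plus_resolvent_route L M a ha hL (perturbationLaws_plantTow L M a ha B) ht

/-- the explicit Neumann radius: every `B` with `‖B‖ ≤ b` is admissible for `‖t‖ < (b·Cst)⁻¹` (`Cst ≥ 1`). [folklore] -/
theorem admissible_of_norm_le {B : Matrix (idx L M 0) (idx L M 0) ℂ} {b : ℝ} (hB : ‖B‖ ≤ b) {t : ℂ}
    (ht : ‖t‖ * (b * Cst d a) < 1) : ‖t‖ * (‖B‖ * Cst d a) < 1 :=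
  lt_of_le_of_lt (mul_le_mul_of_nonneg_left (mul_le_mul_of_nonneg_right hB (Cst_nonneg d a)) (norm_nonneg t)) ht

end Summit.QuantumFields.BalabanUV.T4Continuum.PlantedPotentialRate

end
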